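import Literature.MathematicalPhysics.QuantumFieldTheory.ConstructiveQFTWave0Proofs
import Summits.QuantumFields.YangMills.Theorems.EquipartitionCriticalityFreeEnergyLogCoefficientStubWeakCoupling
import HarnessLib

/-!
# Route `LangevinControlUV`, crux `FemtoCurvatureTwoPointC` (stmt-QuantumFields-16204), line
# `conditional-covariance-floor` — V-corner, input M2: the LATTICE NON-ABELIAN STOKES BOUND

The uniform corner doubling behind `stub_varianceCeilingCorner` (notes `Vc-notes.md` §(c) of the line)
conditions the torus integral `Z_L(β)` on the four based axis holonomies `h_μ = hol(closed e_μ-axis through 0)`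
and needs, for the UPPER bound, that the Wilson action dominates the one-site commutator cost of
`h = (h_μ)`: `S(U) ≥ f(h(U)) / L²` with `f(g) = Σ_{μ<ν} (N − Re tr ρ(g_μ g_ν g_μ⁻¹ g_ν⁻¹))` (Wilson's action on
`(ℤ/1)⁴`, `OneSite.wilsonAction_eq_commutatorCost`). This file proves that inequality for EVERY configuration
(no gauge fixing), from a lattice non-abelian Stokes bound:

* `LatticeStokes.rectangleHolonomy_succ_left`, `…_one_succ` — the word of the `R × T` rectangular loop is an
  ordered product of conjugated plaquette words (row and column recursions, pure group identities);
* `LatticeStokes.norm_one_sub_map_rectangleHolonomy_le` — for a unitary representation `ρ`,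
  `‖1 − ρ(hol ∂(R × T))‖_F ≤ Σ_{p ⊂ R × T} ‖1 − ρ(U_p)‖_F` (subadditivity `‖1 − ρ(ab)‖ ≤ ‖1 − ρ a‖ + ‖1 − ρ b‖`,
  `WeakCoupling.norm_one_sub_map_mul_le`, and conjugation invariance of the Frobenius cost,
  `Matrix.frobenius_norm_unitaryGroup_mul`);
* `LatticeStokes.sub_re_trace_map_rectangleHolonomy_le` — trace form
  `N − Re tr ρ(hol ∂(R × T)) ≤ R T · Σ_{p ⊂ R × T} (N − Re tr ρ(U_p))` (`N − Re tr M = ‖1 − M‖²_F / 2` for unitary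
  `M`, `WeakCoupling.sub_re_trace_eq`, and Cauchy–Schwarz `sq_sum_le_card_mul_sum_sq`);
* `LatticeStokes.rectangleHolonomy_zero_self` — the based `L × L` rectangle IS the commutator
  `h_μ h_ν h_μ⁻¹ h_ν⁻¹` (`L e_μ = 0` on the torus), and `LatticeStokes.sum_face_le_sum_site` — a face is an
  injective family of sites;
* `axisCommutatorCost_le_wilsonAction` (registered sub-goal M2, `--supports stmt-QuantumFields-16204`) —
  `Σ_{μ<ν} (N − Re tr ρ(h_μ h_ν h_μ⁻¹ h_ν⁻¹)) ≤ L² · S(U)`.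

Elementary; Mathlib + landed tree lemmas only; no named facts, no definitions.
-/

set_option autoImplicit false

noncomputable section

open scoped Matrix.Norms.Frobenius
open Literature.MathematicalPhysics.QuantumFieldTheory
open Summit.QuantumFields.YangMills.Theorems.FreeEnergyLogCoefficient

namespace Summit.QuantumFields.YangMills.Theorems.FemtoCurvatureTwoPointC

namespace LatticeStokes

variable {d L : ℕ} {G : Type*} [Group G]

/-- `x + (n+1) e_k = (x + e_k) + n e_k`. -/
theorem add_single_natCast_succ (x : Site d L) (k : Fin d) (n : ℕ) :
    x + Pi.single k (((n + 1 : ℕ) : ZMod L)) = x.shift k + Pi.single k (n : ZMod L) := by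
  rw [Site.shift, add_assoc, ← Pi.single_add, Nat.cast_succ, add_comm (n : ZMod L)]

/-- `(x + v).shift k = x.shift k + v`. -/
theorem add_shift (x v : Site d L) (k : Fin d) : (x + v).shift k = x.shift k + v := add_right_comm _ _ _

/-- A rectangle of width `0` has trivial holonomy. -/
theorem rectangleHolonomy_zero_left (U : GaugeConfig d L G) (x : Site d L) (μ ν : Fin d) (T : ℕ) :
    rectangleHolonomy U x μ ν 0 T = 1 := by
  simp only [rectangleHolonomy, lineHolonomy, Nat.cast_zero, Pi.single_zero, add_zero]
  group

/-- A column of height `0` has trivial holonomy. -/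
theorem rectangleHolonomy_one_zero (U : GaugeConfig d L G) (x : Site d L) (μ ν : Fin d) :
    rectangleHolonomy U x μ ν 1 0 = 1 := by
  simp only [rectangleHolonomy, lineHolonomy, Nat.cast_zero, Pi.single_zero, add_zero]
  group

/-- **Column recursion**: the `1 × (T+1)` rectangle is the bottom plaquette times the conjugate (by the
first vertical link) of the `1 × T` rectangle above it. -/
theorem rectangleHolonomy_one_succ (U : GaugeConfig d L G) (x : Site d L) (μ ν : Fin d) (T : ℕ) :
    rectangleHolonomy U x μ ν 1 (T + 1) =
      plaquetteHolonomy U x μ ν * (U (x, ν) * rectangleHolonomy U (x.shift ν) μ ν 1 T * (U (x, ν))⁻¹) := by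
  simp only [rectangleHolonomy, plaquetteHolonomy, lineHolonomy, add_single_natCast_succ, Nat.cast_one]
  simp only [mul_one]
  have h1 : x + Pi.single μ (1 : ZMod L) = x.shift μ := rfl
  have h2 : x.shift ν + Pi.single μ (1 : ZMod L) = (x.shift ν).shift μ := rfl
  rw [h1, h2, WilsonRP.shift_comm x μ ν]
  group

/-- **Row recursion**: the `(R+1) × T` rectangle is the conjugate (by the first horizontal link) of the
`R × T` rectangle to its right, times the first column. -/
theorem rectangleHolonomy_succ_left (U : GaugeConfig d L G) (x : Site d L) (μ ν : Fin d) (R T : ℕ) :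
    rectangleHolonomy U x μ ν (R + 1) T =
      U (x, μ) * rectangleHolonomy U (x.shift μ) μ ν R T * (U (x, μ))⁻¹ * rectangleHolonomy U x μ ν 1 T := by
  simp only [rectangleHolonomy, lineHolonomy, add_single_natCast_succ, Nat.cast_one, add_shift]
  simp only [mul_one]
  have h1 : x + Pi.single μ (1 : ZMod L) = x.shift μ := rfl
  rw [h1]
  group

/-! ### The Frobenius cost `‖1 − ρ g‖` of a group element -/

variable {N : ℕ} (ρ : G →* Matrix (Fin N) (Fin N) ℂ)

/-- Conjugation invariance: `‖1 − ρ(a b a⁻¹)‖ = ‖1 − ρ b‖` for unitary `ρ`. -/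
theorem norm_one_sub_map_conj (hρ : ∀ g, ρ g ∈ Matrix.unitaryGroup (Fin N) ℂ) (a b : G) :
    ‖1 - ρ (a * b * a⁻¹)‖ = ‖1 - ρ b‖ := by
  have e : 1 - ρ (a * b * a⁻¹) = ρ a * (1 - ρ b) * ρ a⁻¹ := by
    rw [Matrix.mul_sub, Matrix.sub_mul, Matrix.mul_one, ← map_mul, ← map_mul, ← map_mul, mul_inv_cancel,
      map_one]
  rw [e, Matrix.frobenius_norm_mul_unitaryGroup _ ⟨ρ a⁻¹, hρ a⁻¹⟩,
    Matrix.frobenius_norm_unitaryGroup_mul ⟨ρ a, hρ a⟩]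

/-- `‖1 − ρ 1‖ = 0`. -/
theorem norm_one_sub_map_one : ‖(1 : Matrix (Fin N) (Fin N) ℂ) - ρ 1‖ = 0 := by
  rw [map_one, sub_self, norm_zero]

/-- **Lattice non-abelian Stokes bound, one column.** `‖1 − ρ(hol ∂(1 × T column at x))‖` is at most the
sum over the `T` plaquettes of the column of `‖1 − ρ(U_p)‖`. -/
theorem norm_one_sub_map_rectangleHolonomy_one_le (hρ : ∀ g, ρ g ∈ Matrix.unitaryGroup (Fin N) ℂ)
    (U : GaugeConfig d L G) (μ ν : Fin d) (T : ℕ) (x : Site d L) :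
    ‖1 - ρ (rectangleHolonomy U x μ ν 1 T)‖ ≤
      ∑ t ∈ Finset.range T, ‖1 - ρ (plaquetteHolonomy U (x + Pi.single ν (t : ZMod L)) μ ν)‖ := by
  induction T generalizing x with
  | zero => rw [rectangleHolonomy_one_zero, norm_one_sub_map_one, Finset.sum_range_zero]
  | succ T ih =>
    rw [rectangleHolonomy_one_succ, Finset.sum_range_succ', Nat.cast_zero, Pi.single_zero, add_zero, add_comm]
    refine (WeakCoupling.norm_one_sub_map_mul_le ρ hρ _ _).trans (add_le_add le_rfl ?_)
    rw [norm_one_sub_map_conj ρ hρ]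
    refine (ih (x.shift ν)).trans_eq (Finset.sum_congr rfl fun t _ => ?_)
    rw [add_single_natCast_succ]

/-- **Lattice non-abelian Stokes bound.** For a unitary representation `ρ`, the Frobenius distance to `1`
of the holonomy of the `R × T` rectangle at `x` in the `(μ, ν)` plane is at most the sum over its `R T`
plaquettes `p = (x + s e_μ + t e_ν; μ, ν)` of `‖1 − ρ(U_p)‖` (the rectangle word is an ordered product of
conjugated plaquette words; subadditivity and conjugation invariance of `g ↦ ‖1 − ρ g‖`). -/
theorem norm_one_sub_map_rectangleHolonomy_le (hρ : ∀ g, ρ g ∈ Matrix.unitaryGroup (Fin N) ℂ)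
    (U : GaugeConfig d L G) (μ ν : Fin d) (R T : ℕ) (x : Site d L) :
    ‖1 - ρ (rectangleHolonomy U x μ ν R T)‖ ≤
      ∑ s ∈ Finset.range R, ∑ t ∈ Finset.range T,
        ‖1 - ρ (plaquetteHolonomy U (x + Pi.single μ (s : ZMod L) + Pi.single ν (t : ZMod L)) μ ν)‖ := by
  induction R generalizing x with
  | zero => rw [rectangleHolonomy_zero_left, norm_one_sub_map_one, Finset.sum_range_zero]
  | succ R ih =>
    rw [rectangleHolonomy_succ_left, Finset.sum_range_succ', Nat.cast_zero, Pi.single_zero, add_zero]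
    refine (WeakCoupling.norm_one_sub_map_mul_le ρ hρ _ _).trans (add_le_add ?_ ?_)
    · rw [norm_one_sub_map_conj ρ hρ]
      refine (ih (x.shift μ)).trans_eq (Finset.sum_congr rfl fun s _ => ?_)
      rw [add_single_natCast_succ]
    · exact norm_one_sub_map_rectangleHolonomy_one_le ρ hρ U μ ν T x

/-! ### Trace form -/

/-- `0 ≤ N − Re tr ρ g` for unitary `ρ`. -/
theorem sub_re_trace_map_nonneg (hρ : ∀ g, ρ g ∈ Matrix.unitaryGroup (Fin N) ℂ) (g : G) :
    0 ≤ (N : ℝ) - (ρ g).trace.re := by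
  rw [WeakCoupling.sub_re_trace_eq ρ hρ]
  positivity

/-- **Stokes bound, trace form.** `N − Re tr ρ(hol ∂(R × T)) ≤ R T · Σ_{p ⊂ R × T} (N − Re tr ρ(U_p))`
(the norm form, `N − Re tr M = ‖1 − M‖²/2` for unitary `M`, and Cauchy–Schwarz). -/
theorem sub_re_trace_map_rectangleHolonomy_le (hρ : ∀ g, ρ g ∈ Matrix.unitaryGroup (Fin N) ℂ)
    (U : GaugeConfig d L G) (μ ν : Fin d) (R T : ℕ) (x : Site d L) :
    (N : ℝ) - (ρ (rectangleHolonomy U x μ ν R T)).trace.re ≤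
      ((R * T : ℕ) : ℝ) * ∑ s ∈ Finset.range R, ∑ t ∈ Finset.range T,
        ((N : ℝ) - (ρ (plaquetteHolonomy U (x + Pi.single μ (s : ZMod L) + Pi.single ν (t : ZMod L)) μ ν)).trace.re) := by
  simp only [WeakCoupling.sub_re_trace_eq ρ hρ]
  set c : ℕ → ℕ → ℝ := fun s t =>
    ‖1 - ρ (plaquetteHolonomy U (x + Pi.single μ (s : ZMod L) + Pi.single ν (t : ZMod L)) μ ν)‖ with hc
  have h1 : ‖1 - ρ (rectangleHolonomy U x μ ν R T)‖ ≤ ∑ s ∈ Finset.range R, ∑ t ∈ Finset.range T, c s t :=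
    norm_one_sub_map_rectangleHolonomy_le ρ hρ U μ ν R T x
  have h2 : (∑ s ∈ Finset.range R, ∑ t ∈ Finset.range T, c s t) ^ 2 ≤
      (R : ℝ) * ∑ s ∈ Finset.range R, ((T : ℝ) * ∑ t ∈ Finset.range T, c s t ^ 2) := by
    refine sq_sum_le_card_mul_sum_sq.trans ?_
    rw [Finset.card_range]
    refine mul_le_mul_of_nonneg_left (Finset.sum_le_sum fun s _ => ?_) (Nat.cast_nonneg _)
    refine sq_sum_le_card_mul_sum_sq.trans ?_
    rw [Finset.card_range]
  calc ‖1 - ρ (rectangleHolonomy U x μ ν R T)‖ ^ 2 / 2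
      ≤ (∑ s ∈ Finset.range R, ∑ t ∈ Finset.range T, c s t) ^ 2 / 2 := by gcongr
    _ ≤ ((R : ℝ) * ∑ s ∈ Finset.range R, ((T : ℝ) * ∑ t ∈ Finset.range T, c s t ^ 2)) / 2 := by gcongr
    _ = ((R * T : ℕ) : ℝ) * ∑ s ∈ Finset.range R, ∑ t ∈ Finset.range T, c s t ^ 2 / 2 := by
      rw [Nat.cast_mul]
      simp only [Finset.mul_sum, Finset.sum_div]
      refine Finset.sum_congr rfl fun s _ => Finset.sum_congr rfl fun t _ => ?_
      ring

/-! ### The based `L × L` rectangle and the face sums -/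

/-- **The based `L × L` rectangle is the commutator of the axis holonomies**: on the torus `(ℤ/L)^d` the
corner `0 + L e_μ` is `0`, so `hol ∂([0,L] e_μ × [0,L] e_ν) = h_μ h_ν h_μ⁻¹ h_ν⁻¹` with `h_k` the holonomy of
the closed axis through `0` in direction `k`. -/
theorem rectangleHolonomy_zero_self (U : GaugeConfig d L G) (μ ν : Fin d) :
    rectangleHolonomy U 0 μ ν L L =
      lineHolonomy U μ L 0 * lineHolonomy U ν L 0 * (lineHolonomy U μ L 0)⁻¹ * (lineHolonomy U ν L 0)⁻¹ := by
  simp only [rectangleHolonomy, ZMod.natCast_self, Pi.single_zero, add_zero]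

/-- The face map `(s, t) ↦ s e_μ + t e_ν` (`μ ≠ ν`) is injective on `[0, L)²`. -/
theorem face_injOn {μ ν : Fin d} (hμν : μ ≠ ν) :
    Set.InjOn (fun p : ℕ × ℕ => (Pi.single μ (p.1 : ZMod L) + Pi.single ν (p.2 : ZMod L) : Site d L))
      ↑(Finset.range L ×ˢ Finset.range L) := by
  rintro ⟨s, t⟩ hst ⟨s', t'⟩ hst' h
  simp only [Finset.coe_product, Set.mem_prod, Finset.mem_coe, Finset.mem_range] at hst hst'
  have hμ := congrFun h μ
  have hν := congrFun h ν
  simp only [Pi.add_apply, Pi.single_eq_same, Pi.single_eq_of_ne hμν, Pi.single_eq_of_ne hμν.symm,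
    add_zero, zero_add] at hμ hν
  have hs : s = s' := by
    have h' := congrArg ZMod.val hμ
    rwa [ZMod.val_cast_of_lt hst.1, ZMod.val_cast_of_lt hst'.1] at h'
  have ht : t = t' := by
    have h' := congrArg ZMod.val hν
    rwa [ZMod.val_cast_of_lt hst.2, ZMod.val_cast_of_lt hst'.2] at h'
  rw [hs, ht]

/-- A face sum of a non-negative site function is at most its total sum over the torus (the face
`{s e_μ + t e_ν | s, t < L}`, `μ ≠ ν`, is an injective family of sites). -/
theorem sum_face_le_sum_site [NeZero L] {μ ν : Fin d} (hμν : μ ≠ ν) (g : Site d L → ℝ) (hg : ∀ y, 0 ≤ g y) :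
    ∑ s ∈ Finset.range L, ∑ t ∈ Finset.range L, g (Pi.single μ (s : ZMod L) + Pi.single ν (t : ZMod L)) ≤
      ∑ y, g y := by
  rw [← Finset.sum_product', ← Finset.sum_image (f := g) (face_injOn hμν)]
  exact Finset.sum_le_univ_sum_of_nonneg hg

end LatticeStokes

open LatticeStokes in
/-- **Registered sub-goal M2 (line `conditional-covariance-floor`, stub `stub_varianceCeilingCorner`): the
commutator cost of the four based axis holonomies is at most `L²` times the Wilson action.** For every group
`G`, every unitary matrix representation `ρ`, every torus `(ℤ/L)⁴` and EVERY configuration `U` (no gauge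
fixing), with `h_μ = lineHolonomy U μ L 0` the holonomy of the closed coordinate axis through `0`,

  `Σ_{μ<ν} (N − Re tr ρ(h_μ h_ν h_μ⁻¹ h_ν⁻¹)) ≤ L² · S(U)`.

Proof: `h_μ h_ν h_μ⁻¹ h_ν⁻¹` is the holonomy of the based `L × L` rectangle in the `(μ, ν)` plane
(`rectangleHolonomy_zero_self`); by the lattice non-abelian Stokes bound in trace form
(`sub_re_trace_map_rectangleHolonomy_le`) its cost is at most `L²` times the sum of the plaquette costs over
the face, an injective sub-family of the `(μ, ν)` plaquettes of the torus (`sum_face_le_sum_site`); all plaquette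
costs are non-negative, and summing over the six planes gives `L² S(U)`. -/
theorem axisCommutatorCost_le_wilsonAction :
    ∀ {G : Type} [Group G] {N : ℕ} (ρ : G →* Matrix (Fin N) (Fin N) ℂ),
      (∀ g, ρ g ∈ Matrix.unitaryGroup (Fin N) ℂ) →
      ∀ {L : ℕ} [NeZero L] (U : GaugeConfig 4 L G),
        ∑ q : {q : Fin 4 × Fin 4 // q.1 < q.2},
            ((N : ℝ) - (ρ (lineHolonomy U q.1.1 L 0 * lineHolonomy U q.1.2 L 0 *
              (lineHolonomy U q.1.1 L 0)⁻¹ * (lineHolonomy U q.1.2 L 0)⁻¹)).trace.re) ≤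
          (L : ℝ) ^ 2 * wilsonAction ρ U := by
  intro G _ N ρ hρ L _ U
  have hq : ∀ q : {q : Fin 4 × Fin 4 // q.1 < q.2},
      (N : ℝ) - (ρ (lineHolonomy U q.1.1 L 0 * lineHolonomy U q.1.2 L 0 *
        (lineHolonomy U q.1.1 L 0)⁻¹ * (lineHolonomy U q.1.2 L 0)⁻¹)).trace.re ≤
        (L : ℝ) ^ 2 * ∑ y : Site 4 L, ((N : ℝ) - (ρ (plaquetteHolonomy U y q.1.1 q.1.2)).trace.re) := by
    intro q
    rw [← rectangleHolonomy_zero_self]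
    refine (sub_re_trace_map_rectangleHolonomy_le ρ hρ U q.1.1 q.1.2 L L 0).trans ?_
    rw [Nat.cast_mul, ← sq]
    refine mul_le_mul_of_nonneg_left ?_ (sq_nonneg _)
    simp only [zero_add]
    exact sum_face_le_sum_site (ne_of_lt q.2)
      (fun y => (N : ℝ) - (ρ (plaquetteHolonomy U y q.1.1 q.1.2)).trace.re) fun y => sub_re_trace_map_nonneg ρ hρ _
  refine (Finset.sum_le_sum fun q _ => hq q).trans_eq ?_
  rw [← Finset.mul_sum, wilsonAction, Fintype.sum_prod_type, Finset.sum_comm]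


end Summit.QuantumFields.YangMills.Theorems.FemtoCurvatureTwoPointC

end
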